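import Mathlib
import Literature.Barriers.QuantumFields.UVStabilityNonUniqueness

/-!
# `Balaban1983to89.T4LimitDensity` — weak limit points of window-bounded ("UV-stable") families of unit-lattice
# measures: the two-sided MEASURE window survives the limit, hence mutual absolute continuity and two-sided
# Radon–Nikodym bounds (cell `pub-balaban`, road item (2) "T⁴ continuum", `t4/T4-DAG.md` node E4, row T4-E4.E)

CITATION HEADER (lean-in-tree rule 2026-08-18).  Sources of the QUOTATIONS in this file (nothing else of the series is
used, reproduced or asserted):
* T. Bałaban, *Convergent renormalization expansions for lattice gauge theories*, Commun. Math. Phys. **119** (1988)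
  243–285 [Balaban1988Convergent] (cell paper B14 = [III]), p. 264, read from the page render exactly as transcribed in
  the sibling module `…Balaban1983to89.B14Cor3` (header (a)): *"Corollary 3. (Ultraviolet Stability). Under the
  assumptions of Theorem 1 there exist constants E₋, E₊ independent of η and T, but depending on g_k, such that
  χ_k(T_η) exp[−(1/g_k²) A(U_k(V_k)) − E₋|T_η|] ≤ ρ_k(V_k) ≤ e^{E₊|T_η|}. (2.50)"*; and p. 264, the sentence before it:
  *"Thus we estimate the integral ∫dV_k ρ_k by a sum of terms similar to the one considered in Sect. 3 [6]"*.
* J. Magnen, V. Rivasseau, R. Sénéor, Commun. Math. Phys. **155** (1993) [MagnenRivasseauSeneor1993] pp. 325–326 (as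
  quoted in `…Balaban1983to89.Missing`): the continuum limit is obtained *"at least through a compactness argument
  using a subsequence of approximations; but the limit is not necessarily unique"*.
* The barrier module `Literature.Barriers.QuantumFields.UVStabilityNonUniqueness` (imported): its CERTIFICATE
  `IsUVStable ν c C ρ := ∀ n, ∀ᵐ x ∂ν, e^{-c} ≤ ρ n x ∧ ρ n x ≤ e^{C}` (the constant-window, density reading of
  (2.50) at fixed unit-lattice volume), its normalised expectations `cutoffExpectation ν ρ A n = ∫ A ρ_n dν / ∫ ρ_n dν`
  and `IsUVStable.limit_mem_Icc` (every subsequential limit `ℓ` of `⟨A⟩_n` for ONE non-negative observable `A` obeys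
  `e^{-(c+C)} ∫ A dν ≤ ℓ ≤ e^{c+C} ∫ A dν`).

WHAT IS PROVED HERE (kernel; Mathlib measure theory; every theorem elementary, tagged [folklore], sorry-free).  The
barrier's ONE-OBSERVABLE statement is upgraded to the MEASURE: on a pseudo-metrisable Borel space `X` with a finite
reference measure `ν`,
§1 `le_of_forall_lintegral_le` / `le_of_forall_integral_le` — two finite Borel measures with `∫ f dμ ≤ ∫ f dκ` for
   every NON-NEGATIVE bounded continuous `f` satisfy `μ ≤ κ` as measures (closed sets through the decreasing
   approximations `IsClosed.apprSeq` of Mathlib's `HasOuterApproxClosed`, then inner regularity of finite measures on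
   pseudo-metrisable spaces); hence (`le_of_tendsto_lintegral`, `le_of_tendsto_lintegral'`, `window_of_tendsto`,
   `window_of_tendsto_probabilityMeasure`) a two-sided window `lo ≤ μ_i ≤ hi` between fixed finite measures PASSES TO
   WEAK LIMITS; the consequences `absolutelyContinuous_of_smul_le` (`a • ν ≤ μ`, `a ≠ 0` ⇒ `ν ≪ μ`; the other direction
   `μ ≤ b • ν ⇒ μ ≪ ν` is Mathlib's `Measure.absolutelyContinuous_of_le_smul`), `rnDeriv_le_of_le_smul`,
   `le_rnDeriv_of_smul_le`, `le_rnDeriv_of_withDensity_le` (the window becomes an a.e. window for `dμ/dν`); and on a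
   compact metrisable `X` weak limit points of probability measures EXIST along subsequences
   (`exists_subseq_tendsto_of_compactSpace`, Mathlib's Prokhorov/Riesz–Markov instance
   `CompactSpace (ProbabilityMeasure X)` + Lévy–Prokhorov metrisability) — the measure-level form of the MRS sentence
   and of the tree's `Missing.hasSubseqContinuumLimit_of_bounded`.
§2 For a cutoff-indexed density family `ρ : ℕ → X → ℝ`: the unit-lattice measures `densMeasure ν ρ n = ρ_n dν` and the
   NORMALISED `cutoffMeasure ν ρ n = (∫ρ_n dν)⁻¹ ρ_n dν` (a probability measure; `integral_cutoffMeasure`: its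
   expectations ARE the barrier's `cutoffExpectation`); `cutoffMeasure_window_of_isUVStable`: the certificate gives
   `e^{-(c+C)} ν ≤ cutoffMeasure n ≤ e^{c+C} ν` at every cutoff; therefore (`limit_window_of_isUVStable`, the same
   from the tree's real limit functionals `limit_window_of_isUVStable'`, `limit_ac_of_isUVStable`,
   `limit_rnDeriv_window_of_isUVStable`) EVERY weak limit point `μ` of the normalised measures along any subsequence
   satisfies `e^{-(c+C)} ν ≤ μ ≤ e^{c+C} ν`, `μ ≪ ν`, `ν ≪ μ`, and `e^{-(c+C)} ≤ dμ/dν ≤ e^{c+C}` `ν`-a.e.: a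
   UV-stability certificate can select no limit point (the barrier) but it does force every limit point to be
   equivalent to the reference measure with the same window — no mass is created on `ν`-null sets and none of `ν`'s
   support is lost.  The two halves are kept SEPARATE because their printed status differs (below): the UPPER half alone
   (`ρ_n ≤ e^{C}` a.e. plus any positive lower bound `z ≤ ∫ρ_n dν` on the partition functions) gives
   `cutoffMeasure n ≤ (e^{C}/z) ν` (`cutoffMeasure_le_of_upper`) and `μ ≪ ν` with `dμ/dν ≤ e^{C}/z` for the limits
   (`limit_le_of_upper`); a LOWER ENVELOPE of the printed V-dependent shape `l(x) ≤ ρ_n(x)` (with `∫ρ_n dν ≤ Z`) gives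
   `Z⁻¹ · l dν ≤ cutoffMeasure n` (`withDensity_le_cutoffMeasure_of_lower`) and, for the limits, `Z⁻¹ l ≤ dμ/dν` and
   `ν|{l > 0} ≪ μ` in the form `ν.withDensity l ≪ μ` (`limit_ge_of_lower`).
§3 THE T4-SIDE NAMED HYPOTHESES (cell `t4/T4-DAG.md` §2 node E4 "non-degeneracy of the limit (optional, not part of
   T)"; NOT printed statements, NOT citations — `def … : Prop` used only as explicit hypotheses): for the laws
   `law K` of the unit-lattice fields `V_K = (K-fold average of U)`, `U` distributed by the Wilson-action Gibbs measure of
   the `K`-th approximation, transported to one fixed unit-lattice configuration space `X` with product Haar measure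
   `ν` — abstract data `(ν, law)` here, because the tree's `GaugeField` carries no topology, so weak convergence of
   measures on it is not expressible in tree vocabulary —: `E4Upper ν law` (`∃ E, ∀ K, law K ≤ e^{E} ν`), `E4Lower ν law`
   (`∃ E, ∀ K, e^{-E} ν ≤ law K`), `E4Hyp := E4Lower ∧ E4Upper`; `e4Hyp_cutoffMeasure_of_isUVStable` (a certified
   density family's normalised measures satisfy it with `E = c + C`); and the E4 conclusions `E4Upper.limit_le`
   (`μ ≤ e^{E} ν`, `μ ≪ ν`, `dμ/dν ≤ e^{E}`), `E4Lower.le_limit` (`e^{-E} ν ≤ μ`, `ν ≪ μ`, `e^{-E} ≤ dμ/dν`),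
   `E4Hyp.limit_window` and, on compact metrisable `X`, `E4Hyp.exists_limit` (limit points exist and all of them are
   Haar-equivalent with the window).
   LOCATED STATUS OF THE HYPOTHESES (read from the quotations above; nothing inferred beyond them is asserted):
   (i) (2.50) is printed for the effective densities `ρ_k` of [Balaban1988Convergent] §2 (the representation (2.18)
   there, the output of the series' renormalization-group procedure including its large-field operations), and the
   text frames it as an estimate of "the integral ∫dV_k ρ_k"; whether, and in which sense, these `ρ_k` equal or
   dominate the densities of the PUSH-FORWARD laws of `V_k` under the Gibbs measures (the object `law K` here) is not
   settled by the quoted text (the cell's T4-DAG §2 O3a / O3-alt and §7 Q6 record the competing readings) — so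
   `E4Upper` for `law` is a HYPOTHESIS, located at B14 p. 264 upper half of (2.50) + such a reading, not a cited fact.  (ii) The printed LOWER half of (2.50) is NOT a uniform
   constant: it carries the small-field characteristic function `χ_k(T_η)` and the factor `exp[−(1/g_k²)A(U_k(V_k))]`,
   and vanishes off the small-field region; a uniform `e^{-E} ν ≤ law K` (`E4Lower`) is therefore STRONGER IN SHAPE
   than what is printed, besides concerning `law` rather than `ρ_k`; the cell records moreover that the derivation of
   the lower half is not printed in d = 4 (cell GAPS.md G-adv3-2; `B14Cor3` leaves L1/L2).  This is why §2 also proves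
   the envelope form with a V-dependent lower function `l`, which is the printed shape.  (iii) Normalisation: for
   probability laws the window constants absorb the partition function (`E = E₋ + E₊` in volume units), as in
   `IsUVStable.limit_mem_Icc`.
WHAT IS *NOT* HERE: no statement of the series is asserted; no claim that `E4Upper`/`E4Lower` hold for Bałaban's
densities or for the true laws; no identification of limit points (uniqueness is the cell's U-spine, `Missing.
HasUniqueLimitPoints`); no construction of the transport of the `K`-dependent unit lattices `GaugeField (P K) K G` to
one type (the data `law` is abstract).  Value = kernel measure theory + located hypotheses, NOT summit progress.  Unit
`b2b-balaban-pv14` (surge node prover #14, gen 3); companion cell rows: CLAIMS.log T4-E4.E, GAPS.md C-pv14-27.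
-/

namespace Literature.MathematicalPhysics.QuantumFieldTheory.Balaban1983to89.T4LimitDensity

open _root_.MeasureTheory Filter Set
open scoped Topology ENNReal NNReal BoundedContinuousFunction
open Literature.Barriers.QuantumFields (IsUVStable cutoffExpectation cutoffExpectation_def)

/-! ## 0. Measure-theoretic preliminaries (no topology): scalar windows, absolute continuity, Radon–Nikodym bounds -/

section Prelim

variable {X : Type*} [MeasurableSpace X]

/-- A scalar multiple `(ENNReal.ofReal r) • ν` of a finite measure is finite. [folklore] -/
theorem isFiniteMeasure_ofReal_smul (ν : Measure X) [IsFiniteMeasure ν] (r : ℝ) :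
    IsFiniteMeasure (ENNReal.ofReal r • ν) :=
  ⟨by rw [Measure.smul_apply, smul_eq_mul]; exact ENNReal.mul_lt_top ENNReal.ofReal_lt_top (measure_lt_top ν _)⟩

/-- Monotonicity of scalar multiplication of measures in both arguments. [folklore] -/
theorem smul_le_smul_measure {a b : ℝ≥0∞} {μ κ : Measure X} (hab : a ≤ b) (h : μ ≤ κ) : a • μ ≤ b • κ :=
  Measure.le_iff'.2 fun s => by
    simp only [Measure.smul_apply, smul_eq_mul]
    exact mul_le_mul' hab (h s)

/-- `a • ν ≤ μ` with `a ≠ 0` gives `ν ≪ μ` (the other direction, `μ ≤ b • ν ⇒ μ ≪ ν`, is Mathlib's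
`Measure.absolutelyContinuous_of_le_smul`). [folklore] -/
theorem absolutelyContinuous_of_smul_le {μ ν : Measure X} {a : ℝ≥0∞} (ha : a ≠ 0) (h : a • ν ≤ μ) : ν ≪ μ :=
  (Measure.absolutelyContinuous_smul ha).trans (Measure.absolutelyContinuous_of_le h)

/-- An upper measure bound `μ ≤ b • ν` is an a.e. upper bound `dμ/dν ≤ b` on the Radon–Nikodym derivative. [folklore] -/
theorem rnDeriv_le_of_le_smul {μ ν : Measure X} [SigmaFinite ν] {b : ℝ≥0∞} (h : μ ≤ b • ν) :
    μ.rnDeriv ν ≤ᵐ[ν] fun _ => b := by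
  refine ae_le_of_forall_setLIntegral_le_of_sigmaFinite (μ.measurable_rnDeriv ν) fun s _ _ => ?_
  calc ∫⁻ x in s, μ.rnDeriv ν x ∂ν ≤ μ s := Measure.setLIntegral_rnDeriv_le s
    _ ≤ (b • ν) s := h s
    _ = ∫⁻ _ in s, b ∂ν := by rw [setLIntegral_const, Measure.smul_apply, smul_eq_mul]

/-- A lower measure bound `a • ν ≤ μ` (with `μ ≪ ν`) is an a.e. lower bound `a ≤ dμ/dν`. [folklore] -/
theorem le_rnDeriv_of_smul_le {μ ν : Measure X} [SigmaFinite ν] [μ.HaveLebesgueDecomposition ν] {a : ℝ≥0∞}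
    (h : a • ν ≤ μ) (hμν : μ ≪ ν) : (fun _ => a) ≤ᵐ[ν] μ.rnDeriv ν := by
  refine ae_le_of_forall_setLIntegral_le_of_sigmaFinite measurable_const fun s hs _ => ?_
  calc ∫⁻ _ in s, a ∂ν = (a • ν) s := by rw [setLIntegral_const, Measure.smul_apply, smul_eq_mul]
    _ ≤ μ s := h s
    _ = ∫⁻ x in s, μ.rnDeriv ν x ∂ν := (Measure.setLIntegral_rnDeriv' hμν hs).symm

/-- A lower ENVELOPE `ν.withDensity l ≤ μ` (with `μ ≪ ν`) is an a.e. lower bound `l ≤ dμ/dν`. [folklore] -/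
theorem le_rnDeriv_of_withDensity_le {μ ν : Measure X} [SigmaFinite ν] [μ.HaveLebesgueDecomposition ν]
    {l : X → ℝ≥0∞} (hl : AEMeasurable l ν) (h : ν.withDensity l ≤ μ) (hμν : μ ≪ ν) :
    l ≤ᵐ[ν] μ.rnDeriv ν := by
  refine ae_le_of_forall_setLIntegral_le_of_sigmaFinite₀ hl fun s hs _ => ?_
  calc ∫⁻ x in s, l x ∂ν = ν.withDensity l s := (withDensity_apply l hs).symm
    _ ≤ μ s := h s
    _ = ∫⁻ x in s, μ.rnDeriv ν x ∂ν := (Measure.setLIntegral_rnDeriv' hμν hs).symm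

end Prelim

/-! ## 1. Kernel: comparison of finite Borel measures through non-negative bounded continuous test functions -/

section Kernel

variable {X : Type*} [MeasurableSpace X] [TopologicalSpace X]

/-- On CLOSED sets, `∫ f dμ ≤ ∫ f dκ` for all non-negative bounded continuous `f` gives `μ F ≤ κ F` (test the
decreasing approximations `IsClosed.apprSeq` of the indicator of `F`). [folklore] -/
theorem measure_isClosed_le_of_forall_lintegral_le [HasOuterApproxClosed X] [OpensMeasurableSpace X]
    {μ κ : Measure X} [IsFiniteMeasure μ] [IsFiniteMeasure κ]
    (h : ∀ f : X →ᵇ ℝ≥0, ∫⁻ x, f x ∂μ ≤ ∫⁻ x, f x ∂κ) {F : Set X} (hF : IsClosed F) : μ F ≤ κ F :=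
  le_of_tendsto_of_tendsto' (HasOuterApproxClosed.tendsto_lintegral_apprSeq hF μ)
    (HasOuterApproxClosed.tendsto_lintegral_apprSeq hF κ) fun n => h (hF.apprSeq n)

/-- KERNEL COMPARISON LEMMA.  Two finite Borel measures on a pseudo-metrisable space with `∫ f dμ ≤ ∫ f dκ` for every
non-negative bounded continuous `f` satisfy `μ ≤ κ` AS MEASURES (closed sets by the previous lemma, all Borel sets by
inner regularity of finite measures on pseudo-metrisable spaces). [folklore] -/
theorem le_of_forall_lintegral_le [TopologicalSpace.PseudoMetrizableSpace X] [BorelSpace X]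
    {μ κ : Measure X} [IsFiniteMeasure μ] [IsFiniteMeasure κ]
    (h : ∀ f : X →ᵇ ℝ≥0, ∫⁻ x, f x ∂μ ≤ ∫⁻ x, f x ∂κ) : μ ≤ κ := by
  rw [Measure.le_iff]
  intro s hs
  rw [hs.measure_eq_iSup_isClosed_of_ne_top (measure_ne_top μ s)]
  exact iSup_le fun F => iSup_le fun hFs => iSup_le fun hF =>
    (measure_isClosed_le_of_forall_lintegral_le h hF).trans (measure_mono hFs)

/-- The same with REAL integrals of non-negative real bounded continuous functions (the form in which limits of
expectations arrive). [folklore] -/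
theorem le_of_forall_integral_le [TopologicalSpace.PseudoMetrizableSpace X] [BorelSpace X]
    {μ κ : Measure X} [IsFiniteMeasure μ] [IsFiniteMeasure κ]
    (h : ∀ f : X →ᵇ ℝ, (∀ x, 0 ≤ f x) → ∫ x, f x ∂μ ≤ ∫ x, f x ∂κ) : μ ≤ κ := by
  refine le_of_forall_lintegral_le fun f => ?_
  have key : ∫ x, (f x : ℝ) ∂μ ≤ ∫ x, (f x : ℝ) ∂κ :=
    h (BoundedContinuousFunction.comp _ NNReal.isometry_coe.lipschitz f) fun x => (f x).coe_nonneg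
  rw [← BoundedContinuousFunction.toReal_lintegral_coe_eq_integral f μ,
    ← BoundedContinuousFunction.toReal_lintegral_coe_eq_integral f κ] at key
  exact (ENNReal.toReal_le_toReal (f.lintegral_lt_top_of_nnreal μ).ne
    (f.lintegral_lt_top_of_nnreal κ).ne).mp key

/-- LOWER BOUNDS PASS TO WEAK LIMITS: if `∫ f dμ_i → ∫ f dμ` for every non-negative bounded continuous `f` and
eventually `lo ≤ μ_i`, then `lo ≤ μ`. [folklore] -/
theorem le_of_tendsto_lintegral [TopologicalSpace.PseudoMetrizableSpace X] [BorelSpace X]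
    {ι : Type*} {L : Filter ι} [L.NeBot] {μs : ι → Measure X} {μ lo : Measure X}
    [IsFiniteMeasure μ] [IsFiniteMeasure lo]
    (hlim : ∀ f : X →ᵇ ℝ≥0, Tendsto (fun i => ∫⁻ x, f x ∂μs i) L (𝓝 (∫⁻ x, f x ∂μ)))
    (hlo : ∀ᶠ i in L, lo ≤ μs i) : lo ≤ μ :=
  le_of_forall_lintegral_le fun f =>
    ge_of_tendsto (hlim f) (hlo.mono fun _ hi => lintegral_mono' hi le_rfl)

/-- UPPER BOUNDS PASS TO WEAK LIMITS: if `∫ f dμ_i → ∫ f dμ` for every non-negative bounded continuous `f` and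
eventually `μ_i ≤ hi`, then `μ ≤ hi`. [folklore] -/
theorem le_of_tendsto_lintegral' [TopologicalSpace.PseudoMetrizableSpace X] [BorelSpace X]
    {ι : Type*} {L : Filter ι} [L.NeBot] {μs : ι → Measure X} {μ hi : Measure X}
    [IsFiniteMeasure μ] [IsFiniteMeasure hi]
    (hlim : ∀ f : X →ᵇ ℝ≥0, Tendsto (fun i => ∫⁻ x, f x ∂μs i) L (𝓝 (∫⁻ x, f x ∂μ)))
    (hhi : ∀ᶠ i in L, μs i ≤ hi) : μ ≤ hi :=
  le_of_forall_lintegral_le fun f =>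
    le_of_tendsto (hlim f) (hhi.mono fun _ hi' => lintegral_mono' hi' le_rfl)

/-- THE WINDOW IS WEAKLY CLOSED (finite measures): a weak limit of finite measures eventually squeezed between two
fixed finite measures is squeezed between them. [folklore] -/
theorem window_of_tendsto [TopologicalSpace.PseudoMetrizableSpace X] [BorelSpace X]
    {ι : Type*} {L : Filter ι} [L.NeBot] {μs : ι → FiniteMeasure X} {μ : FiniteMeasure X}
    (hlim : Tendsto μs L (𝓝 μ)) {lo hi : Measure X} [IsFiniteMeasure lo] [IsFiniteMeasure hi]
    (hlo : ∀ᶠ i in L, lo ≤ (μs i : Measure X)) (hhi : ∀ᶠ i in L, (μs i : Measure X) ≤ hi) :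
    lo ≤ (μ : Measure X) ∧ (μ : Measure X) ≤ hi := by
  rw [FiniteMeasure.tendsto_iff_forall_lintegral_tendsto] at hlim
  exact ⟨le_of_tendsto_lintegral hlim hlo, le_of_tendsto_lintegral' hlim hhi⟩

/-- THE WINDOW IS WEAKLY CLOSED (probability measures, Mathlib's topology of convergence in distribution). [folklore] -/
theorem window_of_tendsto_probabilityMeasure [TopologicalSpace.PseudoMetrizableSpace X] [BorelSpace X]
    {ι : Type*} {L : Filter ι} [L.NeBot] {μs : ι → ProbabilityMeasure X} {μ : ProbabilityMeasure X}
    (hlim : Tendsto μs L (𝓝 μ)) {lo hi : Measure X} [IsFiniteMeasure lo] [IsFiniteMeasure hi]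
    (hlo : ∀ᶠ i in L, lo ≤ (μs i : Measure X)) (hhi : ∀ᶠ i in L, (μs i : Measure X) ≤ hi) :
    lo ≤ (μ : Measure X) ∧ (μ : Measure X) ≤ hi := by
  rw [ProbabilityMeasure.tendsto_iff_forall_lintegral_tendsto] at hlim
  exact ⟨le_of_tendsto_lintegral hlim hlo, le_of_tendsto_lintegral' hlim hhi⟩

/-- EXISTENCE OF WEAK LIMIT POINTS on a compact metrisable space: every sequence of probability measures has a
weakly convergent subsequence (Mathlib: `ProbabilityMeasure X` is compact — Riesz–Markov–Kakutani/Prokhorov — and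
metrisable by the Lévy–Prokhorov metric).  The measure-level form of "at least through a compactness argument using
a subsequence of approximations" (MRS pp. 325–326). [folklore] -/
theorem exists_subseq_tendsto_of_compactSpace [TopologicalSpace.PseudoMetrizableSpace X] [T2Space X]
    [TopologicalSpace.SeparableSpace X] [CompactSpace X] [BorelSpace X] (μs : ℕ → ProbabilityMeasure X) :
    ∃ μ : ProbabilityMeasure X, ∃ φ : ℕ → ℕ, StrictMono φ ∧ Tendsto (μs ∘ φ) atTop (𝓝 μ) := by
  obtain ⟨μ, -, φ, hφ, h⟩ := isCompact_univ.tendsto_subseq (x := μs) fun _ => Set.mem_univ _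
  exact ⟨μ, φ, hφ, h⟩

end Kernel

/-! ## 2. Cutoff-indexed density families: the unit-lattice measures `ρ_n dν`, their normalisations, and the window -/

section Density

variable {X : Type*} [MeasurableSpace X] (ν : Measure X) (ρ : ℕ → X → ℝ)

/-- The cutoff-`n` unit-lattice measure `ρ_n dν` (negative part of `ρ_n` cut off by `ENNReal.ofReal`; for certified
families `ρ_n ≥ 0` a.e.). [folklore] -/
noncomputable def densMeasure (n : ℕ) : Measure X := ν.withDensity fun x => ENNReal.ofReal (ρ n x)

/-- The NORMALISED cutoff-`n` measure `(∫ ρ_n dν)⁻¹ ρ_n dν` — the probability law whose expectations are the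
barrier module's `cutoffExpectation ν ρ · n` (`integral_cutoffMeasure`). [folklore] -/
noncomputable def cutoffMeasure (n : ℕ) : Measure X :=
  (ENNReal.ofReal (∫ x, ρ n x ∂ν))⁻¹ • densMeasure ν ρ n

variable {ν ρ}

/-- An a.e. constant upper bound on the density is an upper measure bound. [folklore] -/
theorem densMeasure_le_smul {n : ℕ} {u : ℝ} (hu : ∀ᵐ x ∂ν, ρ n x ≤ u) :
    densMeasure ν ρ n ≤ ENNReal.ofReal u • ν :=
  (withDensity_mono (hu.mono fun _ hx => ENNReal.ofReal_le_ofReal hx)).trans_eq (withDensity_const _)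

/-- An a.e. constant lower bound on the density is a lower measure bound. [folklore] -/
theorem smul_le_densMeasure {n : ℕ} {l : ℝ} (hl : ∀ᵐ x ∂ν, l ≤ ρ n x) :
    ENNReal.ofReal l • ν ≤ densMeasure ν ρ n :=
  (withDensity_const (μ := ν) (ENNReal.ofReal l)).symm.trans_le
    (withDensity_mono (hl.mono fun _ hx => ENNReal.ofReal_le_ofReal hx))

/-- An a.e. lower ENVELOPE `l ≤ ρ_n` (a function, as in the printed lower half of (2.50)) is a lower measure bound
`l dν ≤ ρ_n dν`. [folklore] -/
theorem withDensity_le_densMeasure {n : ℕ} {l : X → ℝ} (hl : ∀ᵐ x ∂ν, l x ≤ ρ n x) :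
    ν.withDensity (fun x => ENNReal.ofReal (l x)) ≤ densMeasure ν ρ n :=
  withDensity_mono (hl.mono fun _ hx => ENNReal.ofReal_le_ofReal hx)

/-- Total mass of `ρ_n dν` is the partition function `∫ ρ_n dν` (integrable, a.e. non-negative `ρ_n`). [folklore] -/
theorem densMeasure_univ {n : ℕ} (hi : Integrable (ρ n) ν) (h0 : 0 ≤ᵐ[ν] ρ n) :
    densMeasure ν ρ n univ = ENNReal.ofReal (∫ x, ρ n x ∂ν) := by
  rw [densMeasure, withDensity_apply _ MeasurableSet.univ, Measure.restrict_univ,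
    ofReal_integral_eq_lintegral_ofReal hi h0]

/-- `ρ_n dν` is a finite measure for integrable `ρ_n`. [folklore] -/
theorem isFiniteMeasure_densMeasure {n : ℕ} (hi : Integrable (ρ n) ν) : IsFiniteMeasure (densMeasure ν ρ n) :=
  isFiniteMeasure_withDensity_ofReal hi.hasFiniteIntegral

/-- The normalised cutoff measure is a probability measure (positive partition function). [folklore] -/
theorem isProbabilityMeasure_cutoffMeasure {n : ℕ} (hi : Integrable (ρ n) ν) (h0 : 0 ≤ᵐ[ν] ρ n)
    (hZ : 0 < ∫ x, ρ n x ∂ν) : IsProbabilityMeasure (cutoffMeasure ν ρ n) := by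
  constructor
  rw [cutoffMeasure, Measure.smul_apply, smul_eq_mul, densMeasure_univ hi h0]
  exact ENNReal.inv_mul_cancel (ENNReal.ofReal_pos.2 hZ).ne' ENNReal.ofReal_ne_top

/-- DICTIONARY: the expectations of the normalised cutoff measure ARE the barrier module's `cutoffExpectation`
(measurable a.e. non-negative density, positive partition function; any real observable `A` — both sides take the
same Bochner junk value when `A ρ_n` is not integrable). [folklore] -/
theorem integral_cutoffMeasure {n : ℕ} (hm : Measurable (ρ n)) (h0 : 0 ≤ᵐ[ν] ρ n) (hZ : 0 < ∫ x, ρ n x ∂ν)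
    (A : X → ℝ) : ∫ x, A x ∂(cutoffMeasure ν ρ n) = cutoffExpectation ν ρ A n := by
  rw [cutoffExpectation_def, cutoffMeasure, integral_smul_measure, densMeasure,
    integral_withDensity_eq_integral_toReal_smul₀ hm.ennreal_ofReal.aemeasurable
      (Eventually.of_forall fun _ => ENNReal.ofReal_lt_top),
    ENNReal.toReal_inv, ENNReal.toReal_ofReal hZ.le, div_eq_inv_mul]
  simp only [smul_eq_mul]
  congr 1
  exact integral_congr_ae (h0.mono fun x hx => by
    show (ENNReal.ofReal (ρ n x)).toReal * A x = A x * ρ n x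
    rw [ENNReal.toReal_ofReal hx, mul_comm])

/-- UPPER HALF ALONE: `ρ_n ≤ e^{C}` a.e. and a positive lower bound `z ≤ ∫ ρ_n dν` on the partition function give
`cutoffMeasure n ≤ (e^{C} / z) • ν`. [folklore] -/
theorem cutoffMeasure_le_of_upper {n : ℕ} {C z : ℝ} (hu : ∀ᵐ x ∂ν, ρ n x ≤ Real.exp C) (hz : 0 < z)
    (hZ : z ≤ ∫ x, ρ n x ∂ν) : cutoffMeasure ν ρ n ≤ ENNReal.ofReal (Real.exp C / z) • ν := by
  have hinv : (ENNReal.ofReal (∫ x, ρ n x ∂ν))⁻¹ ≤ ENNReal.ofReal z⁻¹ := by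
    rw [ENNReal.ofReal_inv_of_pos hz]
    exact ENNReal.inv_le_inv.2 (ENNReal.ofReal_le_ofReal hZ)
  calc cutoffMeasure ν ρ n ≤ ENNReal.ofReal z⁻¹ • (ENNReal.ofReal (Real.exp C) • ν) :=
        smul_le_smul_measure hinv (densMeasure_le_smul hu)
    _ = ENNReal.ofReal (Real.exp C / z) • ν := by
        rw [smul_smul, ← ENNReal.ofReal_mul (inv_pos.2 hz).le, inv_mul_eq_div]

/-- LOWER ENVELOPE ALONE: `l ≤ ρ_n` a.e. and an upper bound `∫ ρ_n dν ≤ Z` on the partition function give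
`Z⁻¹ • (l dν) ≤ cutoffMeasure n`. [folklore] -/
theorem withDensity_le_cutoffMeasure_of_lower {n : ℕ} {l : X → ℝ} {Z : ℝ} (hl : ∀ᵐ x ∂ν, l x ≤ ρ n x)
    (hZ : ∫ x, ρ n x ∂ν ≤ Z) :
    (ENNReal.ofReal Z)⁻¹ • ν.withDensity (fun x => ENNReal.ofReal (l x)) ≤ cutoffMeasure ν ρ n :=
  smul_le_smul_measure (ENNReal.inv_le_inv.2 (ENNReal.ofReal_le_ofReal hZ)) (withDensity_le_densMeasure hl)

variable [IsProbabilityMeasure ν] {c C : ℝ}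

/-- THE CERTIFICATE AS A MEASURE WINDOW: `IsUVStable ν c C ρ` (measurable `ρ_n`) gives, at every cutoff,
`e^{-(c+C)} ν ≤ cutoffMeasure n ≤ e^{c+C} ν` — the measure form of `IsUVStable.cutoffExpectation_mem_Icc`. [folklore] -/
theorem cutoffMeasure_window_of_isUVStable (h : IsUVStable ν c C ρ) (hm : ∀ n, Measurable (ρ n)) (n : ℕ) :
    ENNReal.ofReal (Real.exp (-(c + C))) • ν ≤ cutoffMeasure ν ρ n ∧
      cutoffMeasure ν ρ n ≤ ENNReal.ofReal (Real.exp (c + C)) • ν := by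
  have hZl := h.exp_neg_le_integral hm n
  have hZu := h.integral_le_exp hm n
  have hzu : (ENNReal.ofReal (∫ x, ρ n x ∂ν))⁻¹ ≤ ENNReal.ofReal (Real.exp c) := by
    have : Real.exp c = (Real.exp (-c))⁻¹ := by rw [Real.exp_neg, inv_inv]
    rw [this, ENNReal.ofReal_inv_of_pos (Real.exp_pos _)]
    exact ENNReal.inv_le_inv.2 (ENNReal.ofReal_le_ofReal hZl)
  have hzl : ENNReal.ofReal (Real.exp (-C)) ≤ (ENNReal.ofReal (∫ x, ρ n x ∂ν))⁻¹ := by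
    rw [Real.exp_neg, ENNReal.ofReal_inv_of_pos (Real.exp_pos _)]
    exact ENNReal.inv_le_inv.2 (ENNReal.ofReal_le_ofReal hZu)
  constructor
  · calc ENNReal.ofReal (Real.exp (-(c + C))) • ν
        = ENNReal.ofReal (Real.exp (-C)) • (ENNReal.ofReal (Real.exp (-c)) • ν) := by
          rw [show -(c + C) = -C + -c by ring, Real.exp_add, ENNReal.ofReal_mul (Real.exp_pos _).le,
            ← smul_smul]
      _ ≤ cutoffMeasure ν ρ n :=
          smul_le_smul_measure hzl (smul_le_densMeasure ((h n).mono fun _ hx => hx.1))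
  · calc cutoffMeasure ν ρ n ≤ ENNReal.ofReal (Real.exp c) • (ENNReal.ofReal (Real.exp C) • ν) :=
          smul_le_smul_measure hzu (densMeasure_le_smul ((h n).mono fun _ hx => hx.2))
      _ = ENNReal.ofReal (Real.exp (c + C)) • ν := by
          rw [smul_smul, ← ENNReal.ofReal_mul (Real.exp_pos _).le, ← Real.exp_add]

/-- The normalised cutoff measures of a certified family are probability measures. [folklore] -/
theorem isProbabilityMeasure_cutoffMeasure_of_isUVStable (h : IsUVStable ν c C ρ) (hm : ∀ n, Measurable (ρ n))
    (n : ℕ) : IsProbabilityMeasure (cutoffMeasure ν ρ n) :=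
  isProbabilityMeasure_cutoffMeasure (h.integrable hm n) (h.nonneg_ae n) (h.integral_pos hm n)

variable [TopologicalSpace X] [TopologicalSpace.PseudoMetrizableSpace X] [BorelSpace X]

/-- EVERY WEAK LIMIT POINT OF A CERTIFIED FAMILY OBEYS THE SAME MEASURE WINDOW: if along a subsequence `φ` the
normalised cutoff measures converge weakly (tested on non-negative bounded continuous functions) to a finite measure
`μ`, then `e^{-(c+C)} ν ≤ μ ≤ e^{c+C} ν`.  The measure-level upgrade of `IsUVStable.limit_mem_Icc`. [folklore] -/
theorem limit_window_of_isUVStable (h : IsUVStable ν c C ρ) (hm : ∀ n, Measurable (ρ n))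
    {μ : Measure X} [IsFiniteMeasure μ] {φ : ℕ → ℕ}
    (hlim : ∀ f : X →ᵇ ℝ≥0,
      Tendsto (fun n => ∫⁻ x, f x ∂(cutoffMeasure ν ρ (φ n))) atTop (𝓝 (∫⁻ x, f x ∂μ))) :
    ENNReal.ofReal (Real.exp (-(c + C))) • ν ≤ μ ∧ μ ≤ ENNReal.ofReal (Real.exp (c + C)) • ν := by
  haveI := isFiniteMeasure_ofReal_smul ν (Real.exp (-(c + C)))
  haveI := isFiniteMeasure_ofReal_smul ν (Real.exp (c + C))
  exact ⟨le_of_tendsto_lintegral hlim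
      (Eventually.of_forall fun n => (cutoffMeasure_window_of_isUVStable h hm (φ n)).1),
    le_of_tendsto_lintegral' hlim
      (Eventually.of_forall fun n => (cutoffMeasure_window_of_isUVStable h hm (φ n)).2)⟩

/-- The same from the tree's REAL LIMIT FUNCTIONALS: if `μ` represents the subsequential limits of the barrier's
`cutoffExpectation ν ρ f (φ n)` for all non-negative real bounded continuous `f` (this is where
`IsUVStable.limit_mem_Icc` lives), then `e^{-(c+C)} ν ≤ μ ≤ e^{c+C} ν`. [folklore] -/
theorem limit_window_of_isUVStable' (h : IsUVStable ν c C ρ) (hm : ∀ n, Measurable (ρ n))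
    {μ : Measure X} [IsFiniteMeasure μ] {φ : ℕ → ℕ}
    (hlim : ∀ f : X →ᵇ ℝ, (∀ x, 0 ≤ f x) →
      Tendsto (fun n => cutoffExpectation ν ρ f (φ n)) atTop (𝓝 (∫ x, f x ∂μ))) :
    ENNReal.ofReal (Real.exp (-(c + C))) • ν ≤ μ ∧ μ ≤ ENNReal.ofReal (Real.exp (c + C)) • ν := by
  haveI := isFiniteMeasure_ofReal_smul ν (Real.exp (-(c + C)))
  haveI := isFiniteMeasure_ofReal_smul ν (Real.exp (c + C))
  constructor
  · refine le_of_forall_integral_le fun f hf => ?_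
    have hb := fun n => (h.cutoffExpectation_mem_Icc hm (f.integrable ν) (Eventually.of_forall hf) (φ n)).1
    have key := ge_of_tendsto (hlim f hf) (Eventually.of_forall hb)
    rw [integral_smul_measure, ENNReal.toReal_ofReal (Real.exp_pos _).le, smul_eq_mul]
    exact key
  · refine le_of_forall_integral_le fun f hf => ?_
    have hb := fun n => (h.cutoffExpectation_mem_Icc hm (f.integrable ν) (Eventually.of_forall hf) (φ n)).2
    have key := le_of_tendsto (hlim f hf) (Eventually.of_forall hb)
    rw [integral_smul_measure, ENNReal.toReal_ofReal (Real.exp_pos _).le, smul_eq_mul]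
    exact key

/-- Consequence: every such weak limit point is EQUIVALENT to the reference measure, `μ ≪ ν` and `ν ≪ μ`. [folklore] -/
theorem limit_ac_of_isUVStable (h : IsUVStable ν c C ρ) (hm : ∀ n, Measurable (ρ n))
    {μ : Measure X} [IsFiniteMeasure μ] {φ : ℕ → ℕ}
    (hlim : ∀ f : X →ᵇ ℝ≥0,
      Tendsto (fun n => ∫⁻ x, f x ∂(cutoffMeasure ν ρ (φ n))) atTop (𝓝 (∫⁻ x, f x ∂μ))) :
    μ ≪ ν ∧ ν ≪ μ :=
  have hw := limit_window_of_isUVStable h hm hlim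
  ⟨Measure.absolutelyContinuous_of_le_smul hw.2,
    absolutelyContinuous_of_smul_le (ENNReal.ofReal_pos.2 (Real.exp_pos _)).ne' hw.1⟩

/-- Consequence: the Radon–Nikodym derivative of every such weak limit point obeys the certificate's window,
`e^{-(c+C)} ≤ dμ/dν ≤ e^{c+C}` `ν`-a.e. [folklore] -/
theorem limit_rnDeriv_window_of_isUVStable (h : IsUVStable ν c C ρ) (hm : ∀ n, Measurable (ρ n))
    {μ : Measure X} [IsFiniteMeasure μ] {φ : ℕ → ℕ}
    (hlim : ∀ f : X →ᵇ ℝ≥0,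
      Tendsto (fun n => ∫⁻ x, f x ∂(cutoffMeasure ν ρ (φ n))) atTop (𝓝 (∫⁻ x, f x ∂μ))) :
    ∀ᵐ x ∂ν, ENNReal.ofReal (Real.exp (-(c + C))) ≤ μ.rnDeriv ν x ∧
      μ.rnDeriv ν x ≤ ENNReal.ofReal (Real.exp (c + C)) := by
  have hw := limit_window_of_isUVStable h hm hlim
  have hac := (limit_ac_of_isUVStable h hm hlim).1
  filter_upwards [le_rnDeriv_of_smul_le hw.1 hac, rnDeriv_le_of_le_smul hw.2] with x h₁ h₂
  exact ⟨h₁, h₂⟩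

/-- UPPER HALF ALONE IN THE LIMIT: `ρ_n ≤ e^{C}` a.e., `0 ≤ ρ_n` a.e., and `0 < z ≤ ∫ ρ_n dν` for all `n` give, for
every weak limit point `μ` of the normalised measures, `μ ≤ (e^{C}/z) ν`, hence `μ ≪ ν` and `dμ/dν ≤ e^{C}/z` a.e. —
absolute continuity of the limit needs only the upper half (plus any partition-function lower bound). [folklore] -/
theorem limit_le_of_upper {C z : ℝ} (hu : ∀ n, ∀ᵐ x ∂ν, ρ n x ≤ Real.exp C) (hz : 0 < z)
    (hZ : ∀ n, z ≤ ∫ x, ρ n x ∂ν) {μ : Measure X} [IsFiniteMeasure μ] {φ : ℕ → ℕ}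
    (hlim : ∀ f : X →ᵇ ℝ≥0,
      Tendsto (fun n => ∫⁻ x, f x ∂(cutoffMeasure ν ρ (φ n))) atTop (𝓝 (∫⁻ x, f x ∂μ))) :
    μ ≤ ENNReal.ofReal (Real.exp C / z) • ν ∧ μ ≪ ν ∧
      (μ.rnDeriv ν ≤ᵐ[ν] fun _ => ENNReal.ofReal (Real.exp C / z)) := by
  haveI := isFiniteMeasure_ofReal_smul ν (Real.exp C / z)
  have hle : μ ≤ ENNReal.ofReal (Real.exp C / z) • ν :=
    le_of_tendsto_lintegral' hlim (Eventually.of_forall fun n => cutoffMeasure_le_of_upper (hu (φ n)) hz (hZ (φ n)))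
  exact ⟨hle, Measure.absolutelyContinuous_of_le_smul hle, rnDeriv_le_of_le_smul hle⟩

/-- LOWER ENVELOPE ALONE IN THE LIMIT: an integrable a.e. envelope `l ≤ ρ_n` and `∫ ρ_n dν ≤ Z` (`0 < Z`) give, for
every weak limit point `μ ≪ ν` of the normalised measures, `Z⁻¹ (l dν) ≤ μ`, hence `(l dν) ≪ μ` (no part of the
region `{l > 0}` is lost) and `Z⁻¹ l ≤ dμ/dν` a.e.  This is the printed SHAPE of the lower half of (2.50) (there
`l = χ_k · exp[−(1/g_k²)A(U_k(·)) − E₋|T_η|]`, transported and normalised). [folklore] -/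
theorem limit_ge_of_lower {l : X → ℝ} {Z : ℝ} (hlm : Measurable l) (hli : Integrable l ν)
    (hl : ∀ n, ∀ᵐ x ∂ν, l x ≤ ρ n x) (hZ0 : 0 < Z) (hZ : ∀ n, ∫ x, ρ n x ∂ν ≤ Z)
    {μ : Measure X} [IsFiniteMeasure μ] (hμν : μ ≪ ν) {φ : ℕ → ℕ}
    (hlim : ∀ f : X →ᵇ ℝ≥0,
      Tendsto (fun n => ∫⁻ x, f x ∂(cutoffMeasure ν ρ (φ n))) atTop (𝓝 (∫⁻ x, f x ∂μ))) :
    (ENNReal.ofReal Z)⁻¹ • ν.withDensity (fun x => ENNReal.ofReal (l x)) ≤ μ ∧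
      ν.withDensity (fun x => ENNReal.ofReal (l x)) ≪ μ ∧
      ((fun x => (ENNReal.ofReal Z)⁻¹ * ENNReal.ofReal (l x)) ≤ᵐ[ν] μ.rnDeriv ν) := by
  haveI : IsFiniteMeasure (ν.withDensity fun x => ENNReal.ofReal (l x)) :=
    isFiniteMeasure_withDensity_ofReal hli.hasFiniteIntegral
  have hZinv : (ENNReal.ofReal Z)⁻¹ ≠ ⊤ := ENNReal.inv_ne_top.2 (ENNReal.ofReal_pos.2 hZ0).ne'
  haveI : IsFiniteMeasure ((ENNReal.ofReal Z)⁻¹ • ν.withDensity fun x => ENNReal.ofReal (l x)) :=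
    ⟨by rw [Measure.smul_apply, smul_eq_mul]; exact ENNReal.mul_lt_top hZinv.lt_top (measure_lt_top _ _)⟩
  have hle : (ENNReal.ofReal Z)⁻¹ • ν.withDensity (fun x => ENNReal.ofReal (l x)) ≤ μ :=
    le_of_tendsto_lintegral hlim
      (Eventually.of_forall fun n => withDensity_le_cutoffMeasure_of_lower (hl (φ n)) (hZ (φ n)))
  refine ⟨hle, ?_, ?_⟩
  · exact (Measure.absolutelyContinuous_smul (ENNReal.inv_ne_zero.2 ENNReal.ofReal_ne_top)).trans
      (Measure.absolutelyContinuous_of_le hle)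
  · have hle' : ν.withDensity ((ENNReal.ofReal Z)⁻¹ • fun x => ENNReal.ofReal (l x)) ≤ μ := by
      rwa [withDensity_smul' _ _ hZinv]
    exact le_rnDeriv_of_withDensity_le ((hlm.ennreal_ofReal.const_mul _).aemeasurable) hle' hμν

end Density

/-! ## 3. The T4-side named hypotheses (cell T4-DAG node E4) and their consequences -/

section E4

variable {X : Type*} [MeasurableSpace X]

/-- NAMED HYPOTHESIS `E4Upper` (T4-DAG §2 E4, upper half; NOT a printed statement, NOT asserted): the laws `law K` of
the unit-lattice fields `V_K` (push-forwards of the step-`K` Gibbs measures under `K` averagings, transported to one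
fixed unit-lattice configuration space `X` with product Haar measure `ν`) are dominated UNIFORMLY in `K` by a multiple
of `ν`: `∃ E, ∀ K, law K ≤ e^{E} ν`.  Located at the UPPER half of [Balaban1988Convergent] (2.50) p. 264
(*"ρ_k(V_k) ≤ e^{E₊|T_η|}"*, constants "independent of η and T") READ FOR THE PUSH-FORWARD LAWS — the printed bound is
for the effective densities `ρ_k` of the representation (2.18) of that paper, and the text frames it as an estimate of
"the integral ∫dV_k ρ_k"; that these `ρ_k` equal or dominate the densities of the laws `law K` is a READING (the cell's
T4-DAG §2 O3a / O3-alt, §7 Q6), not print. [cite: Balaban1988Convergent, (2.50) p.264 (upper half)] -/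
def E4Upper (ν : Measure X) (law : ℕ → Measure X) : Prop :=
  ∃ E : ℝ, ∀ K, law K ≤ ENNReal.ofReal (Real.exp E) • ν

/-- NAMED HYPOTHESIS `E4Lower` (T4-DAG §2 E4, lower half; NOT a printed statement, NOT asserted): a UNIFORM lower bound
`∃ E, ∀ K, e^{-E} ν ≤ law K`.  STRONGER IN SHAPE than the printed lower half of (2.50), which reads
*"χ_k(T_η) exp[−(1/g_k²) A(U_k(V_k)) − E₋|T_η|] ≤ ρ_k(V_k)"* — V-dependent through the small-field characteristic
function `χ_k` and the background action, vanishing off the small-field region (the printed SHAPE is the envelope form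
`limit_ge_of_lower` of §2) —, and again a statement about `law`, not about `ρ_k`; the cell records that the lower
half's derivation is not printed in d = 4 (GAPS.md G-adv3-2). [cite: Balaban1988Convergent, (2.50) p.264 (lower half)] -/
def E4Lower (ν : Measure X) (law : ℕ → Measure X) : Prop :=
  ∃ E : ℝ, ∀ K, ENNReal.ofReal (Real.exp (-E)) • ν ≤ law K

/-- NAMED HYPOTHESIS `E4Hyp := E4Lower ∧ E4Upper` — the two-sided uniform window for the laws of the unit-lattice
fields (T4-DAG §2 E4: "needs the upper half of (2.50) for the TRUE push-forward density … and the lower half"); the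
two-sided READING of (2.50) for the laws, NOT a printed statement, NOT asserted. [cite: Balaban1988Convergent, (2.50) p.264] -/
def E4Hyp (ν : Measure X) (law : ℕ → Measure X) : Prop :=
  E4Lower ν law ∧ E4Upper ν law

/-- A family in the barrier's certificate class satisfies `E4Hyp` for its normalised measures, with `E = c + C`. [folklore] -/
theorem e4Hyp_cutoffMeasure_of_isUVStable {ν : Measure X} [IsProbabilityMeasure ν] {c C : ℝ} {ρ : ℕ → X → ℝ}
    (h : IsUVStable ν c C ρ) (hm : ∀ n, Measurable (ρ n)) : E4Hyp ν (cutoffMeasure ν ρ) :=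
  ⟨⟨c + C, fun K => (cutoffMeasure_window_of_isUVStable h hm K).1⟩,
    ⟨c + C, fun K => (cutoffMeasure_window_of_isUVStable h hm K).2⟩⟩

variable [TopologicalSpace X] [TopologicalSpace.PseudoMetrizableSpace X] [BorelSpace X]
  {ν : Measure X} [IsFiniteMeasure ν] {law : ℕ → Measure X}

/-- E4, UPPER CONCLUSION: under `E4Upper`, every weak limit point `μ` of the laws along a subsequence satisfies
`μ ≤ e^{E} ν` for some `E`, hence `μ ≪ ν` (Haar-absolute continuity of the limit) and `dμ/dν ≤ e^{E}` a.e. [folklore] -/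
theorem E4Upper.limit_le (h : E4Upper ν law) {μ : Measure X} [IsFiniteMeasure μ] {φ : ℕ → ℕ}
    (hlim : ∀ f : X →ᵇ ℝ≥0, Tendsto (fun n => ∫⁻ x, f x ∂law (φ n)) atTop (𝓝 (∫⁻ x, f x ∂μ))) :
    ∃ E : ℝ, μ ≤ ENNReal.ofReal (Real.exp E) • ν ∧ μ ≪ ν ∧
      (μ.rnDeriv ν ≤ᵐ[ν] fun _ => ENNReal.ofReal (Real.exp E)) := by
  obtain ⟨E, hE⟩ := h
  haveI := isFiniteMeasure_ofReal_smul ν (Real.exp E)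
  have hle : μ ≤ ENNReal.ofReal (Real.exp E) • ν :=
    le_of_tendsto_lintegral' hlim (Eventually.of_forall fun n => hE (φ n))
  exact ⟨E, hle, Measure.absolutelyContinuous_of_le_smul hle, rnDeriv_le_of_le_smul hle⟩

/-- E4, LOWER CONCLUSION: under `E4Lower`, every weak limit point `μ` satisfies `e^{-E} ν ≤ μ` for some `E`, hence
`ν ≪ μ` (no Haar-positive set is lost) and, if `μ ≪ ν`, `e^{-E} ≤ dμ/dν` a.e. [folklore] -/
theorem E4Lower.le_limit (h : E4Lower ν law) {μ : Measure X} [IsFiniteMeasure μ] {φ : ℕ → ℕ}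
    (hlim : ∀ f : X →ᵇ ℝ≥0, Tendsto (fun n => ∫⁻ x, f x ∂law (φ n)) atTop (𝓝 (∫⁻ x, f x ∂μ))) :
    ∃ E : ℝ, ENNReal.ofReal (Real.exp (-E)) • ν ≤ μ ∧ ν ≪ μ ∧
      (μ ≪ ν → (fun _ => ENNReal.ofReal (Real.exp (-E))) ≤ᵐ[ν] μ.rnDeriv ν) := by
  obtain ⟨E, hE⟩ := h
  haveI := isFiniteMeasure_ofReal_smul ν (Real.exp (-E))
  have hle : ENNReal.ofReal (Real.exp (-E)) • ν ≤ μ :=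
    le_of_tendsto_lintegral hlim (Eventually.of_forall fun n => hE (φ n))
  exact ⟨E, hle, absolutelyContinuous_of_smul_le (ENNReal.ofReal_pos.2 (Real.exp_pos _)).ne' hle,
    fun hμν => le_rnDeriv_of_smul_le hle hμν⟩

/-- E4, TWO-SIDED: under `E4Hyp`, every weak limit point (in Mathlib's topology of convergence in distribution, along a
subsequence) of the laws, viewed as probability measures, is squeezed `e^{-E} ν ≤ μ ≤ e^{E} ν`, is EQUIVALENT to `ν`,
and has `e^{-E} ≤ dμ/dν ≤ e^{E}` a.e. [folklore] -/
theorem E4Hyp.limit_window {law : ℕ → ProbabilityMeasure X} (h : E4Hyp ν (fun K => (law K : Measure X)))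
    {μ : ProbabilityMeasure X} {φ : ℕ → ℕ} (hlim : Tendsto (law ∘ φ) atTop (𝓝 μ)) :
    ∃ E : ℝ, (ENNReal.ofReal (Real.exp (-E)) • ν ≤ (μ : Measure X) ∧
      (μ : Measure X) ≤ ENNReal.ofReal (Real.exp E) • ν) ∧ ((μ : Measure X) ≪ ν ∧ ν ≪ (μ : Measure X)) ∧
      (∀ᵐ x ∂ν, ENNReal.ofReal (Real.exp (-E)) ≤ (μ : Measure X).rnDeriv ν x ∧
        (μ : Measure X).rnDeriv ν x ≤ ENNReal.ofReal (Real.exp E)) := by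
  obtain ⟨⟨E₁, hE₁⟩, ⟨E₂, hE₂⟩⟩ := h
  rw [ProbabilityMeasure.tendsto_iff_forall_lintegral_tendsto] at hlim
  refine ⟨max E₁ E₂, ?_⟩
  haveI := isFiniteMeasure_ofReal_smul ν (Real.exp (-max E₁ E₂))
  haveI := isFiniteMeasure_ofReal_smul ν (Real.exp (max E₁ E₂))
  have hlo : ENNReal.ofReal (Real.exp (-max E₁ E₂)) • ν ≤ (μ : Measure X) := by
    refine le_of_tendsto_lintegral hlim (Eventually.of_forall fun n => (smul_le_smul_measure ?_ le_rfl).trans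
      (hE₁ (φ n)))
    exact ENNReal.ofReal_le_ofReal (Real.exp_le_exp.2 (neg_le_neg (le_max_left _ _)))
  have hhi : (μ : Measure X) ≤ ENNReal.ofReal (Real.exp (max E₁ E₂)) • ν := by
    refine le_of_tendsto_lintegral' hlim (Eventually.of_forall fun n => (hE₂ (φ n)).trans
      (smul_le_smul_measure ?_ le_rfl))
    exact ENNReal.ofReal_le_ofReal (Real.exp_le_exp.2 (le_max_right _ _))
  have hac : (μ : Measure X) ≪ ν := Measure.absolutelyContinuous_of_le_smul hhi
  refine ⟨⟨hlo, hhi⟩, ⟨hac, absolutelyContinuous_of_smul_le (ENNReal.ofReal_pos.2 (Real.exp_pos _)).ne' hlo⟩, ?_⟩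
  filter_upwards [le_rnDeriv_of_smul_le hlo hac, rnDeriv_le_of_le_smul hhi] with x h₁ h₂
  exact ⟨h₁, h₂⟩

/-- E4, EXISTENCE + WINDOW on a compact metrisable unit-lattice configuration space (e.g. `G^{bonds}` for a compact
metrisable group `G`): under `E4Hyp` the laws have weak limit points along subsequences, and every one of them is
Haar-equivalent with the two-sided window.  Which limit point — uniqueness — is untouched (MRS p. 326 "the limit is not
necessarily unique"; tree `Missing.HasUniqueLimitPoints`). [folklore] -/
theorem E4Hyp.exists_limit [T2Space X] [TopologicalSpace.SeparableSpace X] [CompactSpace X]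
    {law : ℕ → ProbabilityMeasure X} (h : E4Hyp ν (fun K => (law K : Measure X))) :
    ∃ μ : ProbabilityMeasure X, ∃ φ : ℕ → ℕ, StrictMono φ ∧ Tendsto (law ∘ φ) atTop (𝓝 μ) ∧
      ∃ E : ℝ, (ENNReal.ofReal (Real.exp (-E)) • ν ≤ (μ : Measure X) ∧
        (μ : Measure X) ≤ ENNReal.ofReal (Real.exp E) • ν) ∧ ((μ : Measure X) ≪ ν ∧ ν ≪ (μ : Measure X)) := by
  obtain ⟨μ, φ, hφ, hlim⟩ := exists_subseq_tendsto_of_compactSpace law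
  obtain ⟨E, hw, hac, -⟩ := h.limit_window hlim
  exact ⟨μ, φ, hφ, hlim, E, hw, hac⟩

end E4

end Literature.MathematicalPhysics.QuantumFieldTheory.Balaban1983to89.T4LimitDensity
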